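import Summits.BirchSwinnertonDyer.BirchSwinnertonDyer.Theorems.AlignedTransportAtTwoMainConjectureTransportAlignedAtTwoKilfordCopyMultiplicativeLine
import HarnessLib

/-!
# Crux C1 `MainConjectureTransportAlignedAtTwo` (stmt-BirchSwinnertonDyer-22296), line `birth`, residual (R2) `stub_lamLawKilford` (Kilford stratum):
# «ALIGNED AT 2 ⟹ SAME COPY» WITHOUT A DECOMPOSITION OF `J₀(N)[𝔪]` — the direction the `λ`-law consumes needs only `#J₀(N)[𝔪] = 16`
# (width seat att-p3 g17; `--supports 22296`; part 3, sequel of `…KilfordCopySymmetricSocle` / `…KilfordCopyMultiplicativeLine`)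

THEOREMS ONLY (no `def`, no `sorry`, no named fact); pure linear algebra over `𝔽₂`, kernel-checked. BSD is not proved by this; C1 is not closed
by this; `F1Sign2.CopyAlignmentAtTwo` is not proved by this.

Parts 1–2 prove «aligned ⟺ same copy» GIVEN an equivariant identification `Ψ : J₀(N)[𝔪] ≅ ρ̄ ⊗ 𝔽₂²` (MULT2 read through
Boston–Lenstra–Ribet semisimplicity). This file removes that datum for the direction (R2) actually uses — ALIGNED ⟹ SAME COPY
(`…KilfordCopyOfCopyAlignment.sameCopy_of_copyAlignment`): if the two copies were distinct they would be DISJOINT (irreducibility of `ρ̄`,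
here from the swap and the shear alone: `forall_mem_of_mem_of_ne_zero`) and would SPAN the `16`-element `U = J₀(N)[𝔪]`, which builds `Ψ`
internally (`LinearMap.coprod`, `LinearEquiv.ofInjective`, `LinearMap.exists_extend`); part 2 then forces the copies to coincide. So the
multiplicity-two input enters ONLY as the cardinality `#U = 16` (`= 2^4`, the typed `F1Sign2.MultiplicityTwoOnStratumAtTwo` read over
`𝕋/𝔪 = 𝔽₂`), and no semisimplicity / Boston–Lenstra–Ribet statement is needed for this direction.

RESULT: **`range_eq_range_of_eq_of_mem`** — setting of part 2 minus `Ψ`, plus `Nat.card U = 16`; two `π/ρ`-equivariant linear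
embeddings `ψ₁ ψ₂ : 𝔽₂² → U` with a COMMON canonical vector `c ≠ 0`, `ψᵢ c ∈ M₀` (aligned at `2`, (W0)) have the same image.

References (for the reading, not used in the proofs): [Wiese2007Multiplicities, Prop. 2.2, Cor. 4.2]; [KilfordWiese2008, Prop. 2.6, Question 1.9].
-/

set_option autoImplicit false

noncomputable section

-- justification: the `Summit.BirchSwinnertonDyer.BirchSwinnertonDyer.…` path repeats a component (route-file convention)
set_option linter.dupNamespace false

open Matrix
open Summit.BirchSwinnertonDyer.BirchSwinnertonDyer.Theorems.AlignedTransportAtTwoKilfordCopySymmetricSocle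
open Summit.BirchSwinnertonDyer.BirchSwinnertonDyer.Theorems.AlignedTransportAtTwoKilfordCopyMultiplicativeLine

namespace Summit.BirchSwinnertonDyer.BirchSwinnertonDyer.Theorems.AlignedTransportAtTwoKilfordCopySameCopy

variable {V : Type*} [AddCommGroup V] [Module (ZMod 2) V] {G : Type*} [Group G]

/-- Irreducibility of `ρ̄` from the swap and the shear: a `π/ρ`-equivariant linear `ψ : 𝔽₂² → V` that sends ONE non-zero vector into a
`π`-stable submodule `R` sends every vector into `R` (the orbit of any non-zero vector under `⟨s, t⟩ = GL₂(𝔽₂)` contains a basis). [folklore] -/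
theorem forall_mem_of_mem_of_ne_zero (π : Representation (ZMod 2) G V) (ρ : G →* Matrix (Fin 2) (Fin 2) (ZMod 2))
    {gs gt : G} (hgs : ρ gs = !![0, 1; 1, 0]) (hgt : ρ gt = !![1, 1; 0, 1])
    (R : Submodule (ZMod 2) V) (hR : ∀ g, ∀ x ∈ R, π g x ∈ R)
    (ψ : (Fin 2 → ZMod 2) →ₗ[ZMod 2] V) (hψπ : ∀ g a, ψ (ρ g *ᵥ a) = π g (ψ a))
    {a : Fin 2 → ZMod 2} (ha : a ≠ 0) (haR : ψ a ∈ R) (b : Fin 2 → ZMod 2) : ψ b ∈ R := by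
  have hstab : ∀ g x, ψ x ∈ R → ψ (ρ g *ᵥ x) ∈ R := fun g x hx => by rw [hψπ]; exact hR g _ hx
  have hs : ∀ x, ψ x ∈ R → ψ (!![0, 1; 1, 0] *ᵥ x) ∈ R := fun x hx => by simpa only [hgs] using hstab gs x hx
  have ht : ∀ x, ψ x ∈ R → ψ (!![1, 1; 0, 1] *ᵥ x) ∈ R := fun x hx => by simpa only [hgt] using hstab gt x hx
  have key : ∀ a : Fin 2 → ZMod 2, a ≠ 0 →
      a = Pi.single 0 1 ∨ a = Pi.single 1 1 ∨ a = Pi.single 0 1 + Pi.single 1 1 := by decide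
  have hse₀ : (!![0, 1; 1, 0] : Matrix (Fin 2) (Fin 2) (ZMod 2)) *ᵥ Pi.single 0 1 = Pi.single 1 1 := by
    ext i; fin_cases i <;> simp [mulVec, dotProduct, Fin.sum_univ_two]
  have hse₁ : (!![0, 1; 1, 0] : Matrix (Fin 2) (Fin 2) (ZMod 2)) *ᵥ Pi.single 1 1 = Pi.single 0 1 := by
    ext i; fin_cases i <;> simp [mulVec, dotProduct, Fin.sum_univ_two]
  have h11 : (1 : ZMod 2) + 1 = 0 := by decide
  have hte : (!![1, 1; 0, 1] : Matrix (Fin 2) (Fin 2) (ZMod 2)) *ᵥ (Pi.single 0 1 + Pi.single 1 1) = Pi.single 1 1 := by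
    ext i; fin_cases i <;> simp [mulVec, dotProduct, Fin.sum_univ_two, h11]
  have h01 : ψ (Pi.single 0 1) ∈ R ∧ ψ (Pi.single 1 1) ∈ R := by
    rcases key a ha with rfl | rfl | rfl
    · exact ⟨haR, by simpa only [hse₀] using hs _ haR⟩
    · exact ⟨by simpa only [hse₁] using hs _ haR, haR⟩
    · have h1 : ψ (Pi.single 1 1) ∈ R := by simpa only [hte] using ht _ haR
      exact ⟨by simpa only [hse₁] using hs _ h1, h1⟩
  have hb : b = b 0 • (Pi.single 0 1 : Fin 2 → ZMod 2) + b 1 • Pi.single 1 1 := by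
    ext i; fin_cases i <;> simp
  rw [hb, map_add, map_smul, map_smul]
  exact R.add_mem (R.smul_mem _ h01.1) (R.smul_mem _ h01.2)

/-- Two equivariant copies are EQUAL or DISJOINT. [folklore] -/
theorem range_eq_or_disjoint (π : Representation (ZMod 2) G V) (ρ : G →* Matrix (Fin 2) (Fin 2) (ZMod 2))
    {gs gt : G} (hgs : ρ gs = !![0, 1; 1, 0]) (hgt : ρ gt = !![1, 1; 0, 1])
    (ψ₁ ψ₂ : (Fin 2 → ZMod 2) →ₗ[ZMod 2] V)
    (hψπ₁ : ∀ g a, ψ₁ (ρ g *ᵥ a) = π g (ψ₁ a)) (hψπ₂ : ∀ g a, ψ₂ (ρ g *ᵥ a) = π g (ψ₂ a))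
    (hψinj₁ : ∀ a, ψ₁ a = 0 → a = 0) :
    Set.range ψ₁ = Set.range ψ₂ ∨ Disjoint (LinearMap.range ψ₁) (LinearMap.range ψ₂) := by
  have hR₁ : ∀ g, ∀ x ∈ LinearMap.range ψ₁, π g x ∈ LinearMap.range ψ₁ := by
    rintro g _ ⟨a, rfl⟩; exact ⟨ρ g *ᵥ a, hψπ₁ g a⟩
  have hR₂ : ∀ g, ∀ x ∈ LinearMap.range ψ₂, π g x ∈ LinearMap.range ψ₂ := by
    rintro g _ ⟨a, rfl⟩; exact ⟨ρ g *ᵥ a, hψπ₂ g a⟩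
  by_cases hd : Disjoint (LinearMap.range ψ₁) (LinearMap.range ψ₂)
  · exact Or.inr hd
  left
  rw [Submodule.disjoint_def] at hd
  simp only [not_forall, exists_prop] at hd
  obtain ⟨x, ⟨a, rfl⟩, h2, hx⟩ := hd
  have ha : a ≠ 0 := by rintro rfl; exact hx (map_zero ψ₁)
  have h12 : ∀ b, ψ₁ b ∈ LinearMap.range ψ₂ := forall_mem_of_mem_of_ne_zero π ρ hgs hgt _ hR₂ ψ₁ hψπ₁ ha h2
  obtain ⟨a', ha'⟩ := h12 a
  have ha'0 : a' ≠ 0 := by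
    rintro rfl
    rw [map_zero] at ha'
    exact ha (hψinj₁ a ha'.symm)
  have h21 : ∀ b, ψ₂ b ∈ LinearMap.range ψ₁ :=
    forall_mem_of_mem_of_ne_zero π ρ hgs hgt _ hR₁ ψ₂ hψπ₂ ha'0 ⟨a, ha'.symm⟩
  ext x
  constructor
  · rintro ⟨b, rfl⟩; exact h12 b
  · rintro ⟨b, rfl⟩; exact h21 b

/-- **ALIGNED AT 2 ⟹ SAME COPY, with multiplicity two only as `#U = 16`.** Setting of
`…KilfordCopyMultiplicativeLine.exists_forall_mem_iff_eq_zero_or_eq_mulVec` WITHOUT the decomposition datum `Ψ`: `π` a representation of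
`G` on the finite-dimensional `𝔽₂`-space `V`, `ρ : G →* M₂(𝔽₂)` with the swap and the shear in its range, `U ≤ V` `π`-stable with
`Nat.card U = 16` (MULT2: `dim_{𝔽₂} J₀(N)[𝔪] = 4`), `B` nondegenerate symmetric `π`-invariant (W3), `M₀` a set of `8` vectors of the form
`τ m₀` for socle-type `τ` (W1); two `π/ρ`-equivariant linear embeddings `ψ₁ ψ₂ : 𝔽₂² → U` (the copies of `E₁[2] ≅ ρ̄ ≅ E₂[2]` under THE
equivariant identification) whose COMMON canonical vector `c ≠ 0` satisfies `ψᵢ c ∈ M₀` ((W0) + ALIGNED AT 2). Then `range ψ₁ = range ψ₂`.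
Proof: otherwise the copies are disjoint (`range_eq_or_disjoint`), `ψ₁ ⊕ ψ₂` is injective with `16`-element image `= U`, which furnishes the
`Ψ` of part 2, and `range_eq_range_iff_eq_of_mem` forces equality. [folklore] -/
theorem range_eq_range_of_eq_of_mem [FiniteDimensional (ZMod 2) V] (π : Representation (ZMod 2) G V)
    (ρ : G →* Matrix (Fin 2) (Fin 2) (ZMod 2)) {gs gt : G} (hgs : ρ gs = !![0, 1; 1, 0]) (hgt : ρ gt = !![1, 1; 0, 1])
    (U : Submodule (ZMod 2) V) (hπU : ∀ g, ∀ u ∈ U, π g u ∈ U) (hU : Nat.card U = 16)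
    (B : LinearMap.BilinForm (ZMod 2) V) (hB : B.Nondegenerate) (hBsymm : ∀ x y, B x y = B y x)
    (hBπ : ∀ g x y, B (π g x) (π g y) = B x y)
    (M₀ : Set V) (m₀ : V) (hcard : M₀.ncard = 8)
    (hM₀ : ∀ x ∈ M₀, ∃ τ : V →ₗ[ZMod 2] V, (∀ v, τ v ∈ U) ∧ (∀ x y, B (τ x) y = B x (τ y)) ∧
      (∀ g v, τ (π g v) = π g (τ v)) ∧ τ m₀ = x)
    (ψ₁ ψ₂ : (Fin 2 → ZMod 2) →ₗ[ZMod 2] V) (hψU₁ : ∀ a, ψ₁ a ∈ U) (hψU₂ : ∀ a, ψ₂ a ∈ U)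
    (hψπ₁ : ∀ g a, ψ₁ (ρ g *ᵥ a) = π g (ψ₁ a)) (hψπ₂ : ∀ g a, ψ₂ (ρ g *ᵥ a) = π g (ψ₂ a))
    (hψinj₁ : ∀ a, ψ₁ a = 0 → a = 0) (hψinj₂ : ∀ a, ψ₂ a = 0 → a = 0)
    {c : Fin 2 → ZMod 2} (hc : c ≠ 0) (hcM₁ : ψ₁ c ∈ M₀) (hcM₂ : ψ₂ c ∈ M₀) :
    Set.range ψ₁ = Set.range ψ₂ := by
  classical
  rcases range_eq_or_disjoint π ρ hgs hgt ψ₁ ψ₂ hψπ₁ hψπ₂ hψinj₁ with h | hdisj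
  · exact h
  -- the two copies are disjoint: `Φ = ψ₁ ⊕ ψ₂` is injective with image `U`
  set Φ : ((Fin 2 → ZMod 2) × (Fin 2 → ZMod 2)) →ₗ[ZMod 2] V := ψ₁.coprod ψ₂ with hΦdef
  have hΦapply : ∀ p : (Fin 2 → ZMod 2) × (Fin 2 → ZMod 2), Φ p = ψ₁ p.1 + ψ₂ p.2 := fun p => by
    rw [hΦdef, LinearMap.coprod_apply]
  have hker₁ : LinearMap.ker ψ₁ = ⊥ := LinearMap.ker_eq_bot'.mpr hψinj₁
  have hker₂ : LinearMap.ker ψ₂ = ⊥ := LinearMap.ker_eq_bot'.mpr hψinj₂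
  have hΦinj : Function.Injective Φ := by
    rw [← LinearMap.ker_eq_bot, hΦdef, LinearMap.ker_coprod_of_disjoint_range _ _ hdisj, hker₁, hker₂,
      Submodule.prod_bot]
  have hΦU : ∀ p, Φ p ∈ U := fun p => by rw [hΦapply]; exact U.add_mem (hψU₁ _) (hψU₂ _)
  have hcardR : Nat.card (LinearMap.range Φ) = 16 := by
    rw [← Nat.card_congr (LinearEquiv.ofInjective Φ hΦinj).toEquiv, Nat.card_prod, Nat.card_eq_fintype_card,
      Fintype.card_pi, Finset.prod_const, ZMod.card]
    rfl
  have hrangeU : ∀ u ∈ U, ∃ p, Φ p = u := by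
    have hsub : ((LinearMap.range Φ : Submodule (ZMod 2) V) : Set V) ⊆ (U : Set V) := by
      rintro _ ⟨p, rfl⟩; exact hΦU p
    have hUset : (U : Set V).ncard = 16 := by rw [← Nat.card_coe_set_eq]; exact hU
    have hRset : ((LinearMap.range Φ : Submodule (ZMod 2) V) : Set V).ncard = 16 := by
      rw [← Nat.card_coe_set_eq]; exact hcardR
    have hfin : (U : Set V).Finite := Set.finite_of_ncard_ne_zero (by rw [hUset]; decide)
    have heq := Set.eq_of_subset_of_ncard_le hsub (by rw [hUset, hRset]) hfin
    intro u hu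
    have hu' : u ∈ ((LinearMap.range Φ : Submodule (ZMod 2) V) : Set V) := by rw [heq]; exact hu
    exact hu'
  -- the decomposition datum `Ψ`: columns `(a, b)` on `ψ₁ a + ψ₂ b`, extended to `V`
  let Mcol : ((Fin 2 → ZMod 2) × (Fin 2 → ZMod 2)) →ₗ[ZMod 2] Matrix (Fin 2) (Fin 2) (ZMod 2) :=
    { toFun := fun p => Matrix.of fun i j => if j = 0 then p.1 i else p.2 i
      map_add' := fun p q => by
        ext i j
        fin_cases j <;> simp
      map_smul' := fun r p => by
        ext i j
        fin_cases j <;> simp }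
  have hMcol : ∀ p, Mcol p = Matrix.of (fun i j => if j = 0 then p.1 i else p.2 i) := fun p => rfl
  let E := LinearEquiv.ofInjective Φ hΦinj
  obtain ⟨Ψ, hΨ⟩ := LinearMap.exists_extend (Mcol ∘ₗ (E.symm : LinearMap.range Φ →ₗ[ZMod 2] _))
  have hΨΦ : ∀ p, Ψ (Φ p) = Mcol p := by
    intro p
    have h1 : Ψ (Φ p) = (Ψ.comp (LinearMap.range Φ).subtype) (E p) := by
      simp only [LinearMap.comp_apply, Submodule.subtype_apply, E, LinearEquiv.ofInjective_apply]
    rw [h1, hΨ, LinearMap.comp_apply]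
    simp
  -- `Ψ` satisfies the hypotheses of part 2 on `U`
  have hΨinj : ∀ u ∈ U, Ψ u = 0 → u = 0 := by
    intro u hu h0
    obtain ⟨p, rfl⟩ := hrangeU u hu
    rw [hΨΦ] at h0
    have hp : p = 0 := by
      ext i
      · simpa [hMcol] using congrFun (congrFun h0 i) 0
      · simpa [hMcol] using congrFun (congrFun h0 i) 1
    rw [hp, map_zero]
  have hΨsurj : ∀ X : Matrix (Fin 2) (Fin 2) (ZMod 2), ∃ u ∈ U, Ψ u = X := by
    intro X
    refine ⟨Φ (fun i => X i 0, fun i => X i 1), hΦU _, ?_⟩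
    rw [hΨΦ, hMcol]
    ext i j
    fin_cases j <;> simp
  have hΨπ : ∀ g, ∀ u ∈ U, Ψ (π g u) = ρ g * Ψ u := by
    intro g u hu
    obtain ⟨p, rfl⟩ := hrangeU u hu
    have hmove : π g (Φ p) = Φ (ρ g *ᵥ p.1, ρ g *ᵥ p.2) := by
      rw [hΦapply, hΦapply, map_add, hψπ₁, hψπ₂]
    rw [hmove, hΨΦ, hΨΦ, hMcol, hMcol]
    ext i j
    fin_cases j <;> simp [Matrix.mul_apply, mulVec, dotProduct, Fin.sum_univ_two]
  -- part 2 forces the two copies to coincide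
  exact (range_eq_range_iff_eq_of_mem π ρ hgs hgt U hπU Ψ hΨinj hΨsurj hΨπ B hB hBsymm hBπ M₀ m₀ hcard hM₀ ψ₁ ψ₂
    hψU₁ hψU₂ hψπ₁ hψπ₂ hψinj₁ hψinj₂ hc hc hcM₁ hcM₂).mpr rfl

end Summit.BirchSwinnertonDyer.BirchSwinnertonDyer.Theorems.AlignedTransportAtTwoKilfordCopySameCopy

end
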